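import Summits.CriticalPhenomena.PercolationContinuityZ3.Theorems.PercNearOneGluingNoHeavyLowerTailAntitheticSepParse
import HarnessLib

/-!
# `NoHeavyLowerTail` (stmt-CriticalPhenomena-4575) — antithetic cluster pairs: ORBIT-COMPRESSED separable certificates (expand orbit
# representatives under a list of bit permutations; prim-hp-2 gen 67, HOME/MEMO-gen67.md §3(c))

Support file (`--supports stmt-CriticalPhenomena-4575`, hull-port prover `prim-hp-2`, gen 67).  COMPUTABLE DEFINITIONS ONLY; no named facts, no
sorries; standard axioms.

WHY.  The symmetry-reduced separability LP (HOME/code/gen67/kit67/sepsym) produces certificates that are unions of ORBITS of cover pairs under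
the automorphisms of the rooted gadget fixing `s, P, Q` (acting on lattice codes by permuting vertex bits); expanded they have
`Σ |orbit|` entries (14 825 for `(M)(K_{2,5}; c, m)` under `S₄`, 76 000 for the 8-vertex fans under `S₅`) — too long for one proposal.  This
file lets an instance file ship one representative per orbit plus the group: `SepCert.expandCert G reps` applies every bit permutation of
`G` to every representative and removes duplicates inside each orbit.  No soundness obligation: the expansion is just SOME certificate list,
validated by `SepCert.check` (…AntitheticSepCodes / …SepDecide).
* `Antithetic.SepCert.permCode p u` — the code whose bit `p[i]` is bit `i` of `u` (`p` a list of target positions, one per coordinate);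
  `permEntry`, `expandCert`; `parsePerms` — permutations from a string (`|`-separated rows of space-separated naturals).
[cite: VandenbergHaggstromKahn2005, §1 p. 6 ("Harris' inequality")]
-/

namespace Summit.CriticalPhenomena.PercolationContinuityZ3.Theorems

namespace Antithetic

namespace SepCert

/-- Move bit `i` of `u` to position `p[i]` for every coordinate `i < p.length`. [this work] -/
def permCode (p : List ℕ) (u : ℕ) : ℕ :=
  ((List.range p.length).filter fun i => u.testBit i).foldl (fun acc i => acc ||| 2 ^ (p.getD i i)) 0

/-- A bit permutation applied to the four codes of a certificate entry (the coefficient is kept). [this work] -/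
def permEntry (p : List ℕ) (e : ℕ × ℕ × ℕ × ℕ × ℕ) : ℕ × ℕ × ℕ × ℕ × ℕ :=
  (permCode p e.1, permCode p e.2.1, permCode p e.2.2.1, permCode p e.2.2.2.1, e.2.2.2.2)

/-- Expand orbit representatives under a list of bit permutations (the whole group, identity included or not), removing duplicates
within each orbit. [this work] -/
def expandCert (G : List (List ℕ)) (reps : List (ℕ × ℕ × ℕ × ℕ × ℕ)) : List (ℕ × ℕ × ℕ × ℕ × ℕ) :=
  reps.flatMap fun e => (e :: G.map fun p => permEntry p e).eraseDups

/-- Bit permutations read from a string: rows separated by `|`, each a space-separated list of target positions. [this work] -/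
def parsePerms (s : String) : List (List ℕ) := (s.splitOn "|").map parseNats

end SepCert

end Antithetic

end Summit.CriticalPhenomena.PercolationContinuityZ3.Theorems
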